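import Mathlib
import HarnessLib

/-!
# ValiantsHypothesis / SymPencil — crux `EquivariantSdcNotQP` (stmt-ValiantsHypothesis-17792),
# line `birth_EquivariantSdcNotQP`, stub `stub_permify`, piece (ii′) FINITE CONJUGATION LIFT:
# the canonical pair of stable subspaces and coefficient calculus (helper file 2/4)

Two ingredients of the proof of (ii′) `FiniteConjugationLift`:

* `exists_canonical_pair` — for a family `𝒞` of commuting-with-nothing endomorphisms of a
  finite-dimensional space containing a distinguished `N`, the CANONICAL pair `S₀ ≤ S₂` of
  `𝒞`-stable subspaces: `S₂` = the smallest stable subspace containing `ker N`, `S₀` = `S₂` met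
  with the largest stable subspace on which `N` is invertible (the stable core of the Fitting
  range `⨆ {L | N L = L}`).  Both are preserved by every endomorphism `g` commuting with `N` and
  normalising the family (`g 𝒞_i = 𝒞_j g`, `𝒞_i g = g 𝒞_j`).  This replaces the Jordan–Hölder /
  isotypic-component argument of the informal proof: no composition series is needed.
* coefficient calculus for matrices of polynomials: coefficients of `P B Q` (`P`, `Q` constant),
  of `B` renamed along a bijection of the variables, and block-triangularity from coefficients.

All statements are folklore; no definitions, no named facts.
-/

noncomputable section

set_option linter.dupNamespace false

namespace Summit.ValiantsHypothesis.ValiantsHypothesis.Theorems.SymPencilEquivariantSdcNotQP.FiniteLift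

open Matrix Module Submodule MvPolynomial

/-! ### The canonical pair of stable subspaces -/

section Canon

variable {K : Type*} [Field K] {V : Type*} [AddCommGroup V] [Module K V] [FiniteDimensional K V]

/-- A subspace mapped into itself by `N` on which `N` is injective is mapped ONTO itself.
[folklore] -/
theorem map_eq_of_injOn (N : V →ₗ[K] V) (L : Submodule K V) (hL : ∀ x ∈ L, N x ∈ L)
    (hinj : ∀ x ∈ L, N x = 0 → x = 0) : L.map N = L := by
  apply Submodule.eq_of_le_of_finrank_eq (Submodule.map_le_iff_le_comap.mpr fun x hx => hL x hx)
  have hrange : L.map N = LinearMap.range (N ∘ₗ L.subtype) := by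
    rw [LinearMap.range_comp, Submodule.range_subtype]
  rw [hrange]
  apply LinearMap.finrank_range_of_inj
  rw [injective_iff_map_eq_zero]
  rintro ⟨x, hx⟩ h
  have hx0 : x = 0 := hinj x hx (by simpa using h)
  simp [hx0]

/-- **The canonical pair.**  Let `𝒞` be a family of endomorphisms of a finite-dimensional space
containing `N`.  There are `𝒞`-stable subspaces `S₀ ≤ S₂` with: `N` injective on `S₀`;
`ker N ≤ S₂`; `S₂` is the least stable subspace containing `ker N`; every stable `T ≤ S₂` on
which `N` is injective lies in `S₀`; and every endomorphism commuting with `N` and normalising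
the family preserves `S₀` and `S₂`.  (`S₂ = ⋂ {stable L ⊇ ker N}`,
`S₀ = S₂ ⊓ ⨆ {stable L ≤ R}` with `R = ⨆ {L | N L = L}` the Fitting range of `N`.) [folklore] -/
theorem exists_canonical_pair {ι : Type*} (𝒞 : ι → V →ₗ[K] V) (N : V →ₗ[K] V)
    (hN : ∃ i₀, 𝒞 i₀ = N) :
    ∃ S₀ S₂ : Submodule K V,
      S₀ ≤ S₂ ∧
      (∀ i, ∀ x ∈ S₀, 𝒞 i x ∈ S₀) ∧ (∀ i, ∀ x ∈ S₂, 𝒞 i x ∈ S₂) ∧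
      (∀ x ∈ S₀, N x = 0 → x = 0) ∧
      LinearMap.ker N ≤ S₂ ∧
      (∀ T : Submodule K V, (∀ i, ∀ x ∈ T, 𝒞 i x ∈ T) → LinearMap.ker N ≤ T → S₂ ≤ T) ∧
      (∀ T : Submodule K V, (∀ i, ∀ x ∈ T, 𝒞 i x ∈ T) → T ≤ S₂ →
        (∀ x ∈ T, N x = 0 → x = 0) → T ≤ S₀) ∧
      (∀ g : V →ₗ[K] V, (∀ x, g (N x) = N (g x)) →
        (∀ i, ∃ j, ∀ x, g (𝒞 i x) = 𝒞 j (g x)) → (∀ i, ∃ j, ∀ x, 𝒞 i (g x) = g (𝒞 j x)) →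
        (∀ x ∈ S₀, g x ∈ S₀) ∧ (∀ x ∈ S₂, g x ∈ S₂)) := by
  classical
  obtain ⟨i₀, hi₀⟩ := hN
  -- the Fitting range `R = ⨆ {L | N L = L}`
  let R : Submodule K V := ⨆ L : {L : Submodule K V // L.map N = L}, (L : Submodule K V)
  have hR_le : ∀ L : Submodule K V, L.map N = L → L ≤ R := fun L hL =>
    le_iSup (fun L : {L : Submodule K V // L.map N = L} => (L : Submodule K V)) ⟨L, hL⟩
  have hRN : R.map N = R := by
    change (⨆ L : {L : Submodule K V // L.map N = L}, (L : Submodule K V)).map N = _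
    rw [Submodule.map_iSup]
    exact iSup_congr fun L => L.2
  have hRmaps : ∀ x ∈ R, N x ∈ R := fun x hx => by
    have : N x ∈ R.map N := Submodule.mem_map_of_mem hx
    rwa [hRN] at this
  have hRinj : ∀ x ∈ R, N x = 0 → x = 0 := by
    have hsurj : Function.Surjective (N.restrict hRmaps) := by
      rintro ⟨y, hy⟩
      have hy' : y ∈ R.map N := by rwa [hRN]
      obtain ⟨x, hx, rfl⟩ := Submodule.mem_map.mp hy'
      exact ⟨⟨x, hx⟩, rfl⟩
    have hinj : Function.Injective (N.restrict hRmaps) :=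
      LinearMap.injective_iff_surjective.mpr hsurj
    intro x hx hNx
    have h0 : N.restrict hRmaps ⟨x, hx⟩ = 0 := Subtype.ext (by simpa using hNx)
    have := hinj (h0.trans (map_zero _).symm)
    simpa using this
  -- light stable subspaces lie in `R`
  have hlight : ∀ L : Submodule K V, (∀ x ∈ L, N x ∈ L) → (∀ x ∈ L, N x = 0 → x = 0) →
      L ≤ R := fun L hL hinj => hR_le L (map_eq_of_injOn N L hL hinj)
  -- the largest stable subspace inside `R`
  let Smax : Submodule K V :=
    ⨆ L : {L : Submodule K V // (∀ i, ∀ x ∈ L, 𝒞 i x ∈ L) ∧ L ≤ R}, (L : Submodule K V)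
  have hSmax_le : Smax ≤ R := iSup_le fun L => L.2.2
  have hle_Smax : ∀ L : Submodule K V, (∀ i, ∀ x ∈ L, 𝒞 i x ∈ L) → L ≤ R → L ≤ Smax :=
    fun L h1 h2 => le_iSup (fun L : {L : Submodule K V // (∀ i, ∀ x ∈ L, 𝒞 i x ∈ L) ∧ L ≤ R} =>
      (L : Submodule K V)) ⟨L, h1, h2⟩
  have hSmax_stable : ∀ i, ∀ x ∈ Smax, 𝒞 i x ∈ Smax := by
    intro i x hx
    have hmap : Smax.map (𝒞 i) ≤ Smax := by
      change (⨆ L : {L : Submodule K V // (∀ i, ∀ x ∈ L, 𝒞 i x ∈ L) ∧ L ≤ R},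
        (L : Submodule K V)).map (𝒞 i) ≤ _
      rw [Submodule.map_iSup]
      exact iSup_mono fun L => Submodule.map_le_iff_le_comap.mpr fun x hx => L.2.1 i x hx
    exact hmap (Submodule.mem_map_of_mem hx)
  -- the least stable subspace containing `ker N`
  let S : Submodule K V :=
    ⨅ L : {L : Submodule K V // (∀ i, ∀ x ∈ L, 𝒞 i x ∈ L) ∧ LinearMap.ker N ≤ L},
      (L : Submodule K V)
  have hS_stable : ∀ i, ∀ x ∈ S, 𝒞 i x ∈ S := by
    intro i x hx
    rw [Submodule.mem_iInf] at hx ⊢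
    exact fun L => L.2.1 i x (hx L)
  have hkerS : LinearMap.ker N ≤ S := le_iInf fun L => L.2.2
  have hS_min : ∀ T : Submodule K V, (∀ i, ∀ x ∈ T, 𝒞 i x ∈ T) → LinearMap.ker N ≤ T → S ≤ T :=
    fun T h1 h2 => iInf_le (fun L : {L : Submodule K V // (∀ i, ∀ x ∈ L, 𝒞 i x ∈ L) ∧
      LinearMap.ker N ≤ L} => (L : Submodule K V)) ⟨T, h1, h2⟩
  refine ⟨S ⊓ Smax, S, inf_le_left, ?_, hS_stable, ?_, hkerS, hS_min, ?_, ?_⟩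
  · intro i x hx
    exact ⟨hS_stable i x hx.1, hSmax_stable i x hx.2⟩
  · intro x hx hNx
    exact hRinj x (hSmax_le hx.2) hNx
  · intro T hT hTS hTinj
    have hTN : ∀ x ∈ T, N x ∈ T := fun x hx => hi₀ ▸ hT i₀ x hx
    exact le_inf hTS (hle_Smax T hT (hlight T hTN hTinj))
  · intro g hgN h₁ h₂
    -- `S` is preserved: `g⁻¹ S ⊇ S` by minimality
    have hS_g : ∀ x ∈ S, g x ∈ S := by
      have hle : S ≤ S.comap g := by
        apply hS_min
        · intro i x hx
          obtain ⟨j, hj⟩ := h₁ i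
          change g (𝒞 i x) ∈ S
          rw [hj]
          exact hS_stable j _ hx
        · intro x hx
          change g x ∈ S
          apply hkerS
          rw [LinearMap.mem_ker] at hx ⊢
          rw [← hgN, hx, map_zero]
      exact fun x hx => hle hx
    -- `R` is preserved
    have hR_g : R.map g ≤ R := by
      change (⨆ L : {L : Submodule K V // L.map N = L}, (L : Submodule K V)).map g ≤ _
      rw [Submodule.map_iSup]
      refine iSup_le fun L => hR_le _ ?_
      rw [← Submodule.map_comp]
      have hcomm : N ∘ₗ g = g ∘ₗ N := LinearMap.ext fun x => (hgN x).symm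
      rw [hcomm, Submodule.map_comp, L.2]
    -- `Smax` is preserved
    have hSmax_g : Smax.map g ≤ Smax := by
      change (⨆ L : {L : Submodule K V // (∀ i, ∀ x ∈ L, 𝒞 i x ∈ L) ∧ L ≤ R},
        (L : Submodule K V)).map g ≤ _
      rw [Submodule.map_iSup]
      refine iSup_le fun L => hle_Smax _ ?_ ?_
      · intro i y hy
        obtain ⟨x, hx, rfl⟩ := Submodule.mem_map.mp hy
        obtain ⟨j, hj⟩ := h₂ i
        rw [hj]
        exact Submodule.mem_map_of_mem (L.2.1 j x hx)
      · exact (Submodule.map_mono L.2.2).trans hR_g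
    refine ⟨fun x hx => ⟨hS_g x hx.1, hSmax_g (Submodule.mem_map_of_mem hx.2)⟩, hS_g⟩

end Canon

/-! ### Coefficient calculus for matrices of polynomials -/

section Coeff

variable {K : Type*} [CommSemiring K] {σ τ : Type*} {ι₁ ι₂ ι₃ : Type*}

/-- Coefficients of `P · X` for a constant matrix `P`. [folklore] -/
theorem map_coeff_map_C_mul [Fintype ι₂] (P : Matrix ι₁ ι₂ K)
    (X : Matrix ι₂ ι₃ (MvPolynomial σ K)) (d : σ →₀ ℕ) :
    (P.map (C : K →+* MvPolynomial σ K) * X).map (coeff d) = P * X.map (coeff d) := by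
  ext i j
  simp [Matrix.mul_apply, MvPolynomial.coeff_sum, MvPolynomial.coeff_C_mul]

/-- Coefficients of `X · Q` for a constant matrix `Q`. [folklore] -/
theorem map_coeff_mul_map_C [Fintype ι₂] (X : Matrix ι₁ ι₂ (MvPolynomial σ K))
    (Q : Matrix ι₂ ι₃ K) (d : σ →₀ ℕ) :
    (X * Q.map (C : K →+* MvPolynomial σ K)).map (coeff d) = X.map (coeff d) * Q := by
  ext i j
  simp only [Matrix.map_apply, Matrix.mul_apply, MvPolynomial.coeff_sum]
  refine Finset.sum_congr rfl fun l _ => ?_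
  rw [mul_comm, MvPolynomial.coeff_C_mul, mul_comm]

/-- Coefficients of `P · X · Q` for constant matrices `P`, `Q`. [folklore] -/
theorem map_coeff_conj [Fintype ι₁] [Fintype ι₂] (P : Matrix ι₃ ι₁ K)
    (X : Matrix ι₁ ι₂ (MvPolynomial σ K)) (Q : Matrix ι₂ ι₃ K) (d : σ →₀ ℕ) :
    (P.map (C : K →+* MvPolynomial σ K) * X * Q.map (C : K →+* MvPolynomial σ K)).map (coeff d) =
      P * X.map (coeff d) * Q := by
  rw [map_coeff_mul_map_C, map_coeff_map_C_mul]

/-- Coefficients after renaming the variables along a bijection. [folklore] -/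
theorem map_coeff_map_rename (e : σ ≃ τ) (X : Matrix ι₁ ι₂ (MvPolynomial σ K)) (d : τ →₀ ℕ) :
    (X.map (rename e)).map (coeff d) = X.map (coeff (d.mapDomain e.symm)) := by
  ext i j
  simp only [Matrix.map_apply]
  have hd : d = (d.mapDomain e.symm).mapDomain e := by
    rw [← Finsupp.mapDomain_comp, Equiv.self_comp_symm, Finsupp.mapDomain_id]
  conv_lhs => rw [hd]
  exact coeff_rename_mapDomain e e.injective _ _

/-- A matrix of polynomials all of whose coefficient matrices are block triangular is block
triangular. [folklore] -/
theorem blockTriangular_of_map_coeff {ι : Type*} {α : Type*} [LT α]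
    (X : Matrix ι ι (MvPolynomial σ K)) (b : ι → α)
    (h : ∀ d, (X.map (coeff d)).BlockTriangular b) : X.BlockTriangular b := by
  intro i j hij
  ext d
  simpa using h d hij

/-- Renaming commutes with pushing a constant matrix into the polynomial ring. [folklore] -/
theorem map_C_map_rename (f : σ → τ) (P : Matrix ι₁ ι₂ K) :
    (P.map (C : K →+* MvPolynomial σ K)).map (rename f) =
      P.map (C : K →+* MvPolynomial τ K) := by
  ext i j
  simp [Matrix.map_apply]

end Coeff

end Summit.ValiantsHypothesis.ValiantsHypothesis.Theorems.SymPencilEquivariantSdcNotQP.FiniteLift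

end
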